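import Summits.ValiantsHypothesis.ValiantsHypothesis.Theorems.KPlusLogSqLawTropicalBIntervalOpt
import Summits.ValiantsHypothesis.ValiantsHypothesis.Theorems.KPlusLogSqLawTropicalBSplitDefs

/-!
# Route `KPlusLogSqLaw`, crux `TropicalB` (stmt-ValiantsHypothesis-19771) — TWO ENTRIES PER COLUMN ARE LINEAR:
# a static design supported on the union of two permutation matrices has dominant chains of length `n ≤ m`,
# however the two permutations are entangled (the BINARY-BLOCK LAW)

HONEST FRAMING.  Helper file (seat val-sym-trop-p1 g14, cell `pub-symmetroid`, 2026-08-28) toward the registered stubs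
`stub_tropThin` / `stub_tropFat` of `Cruxes/TropicalB/Lines/birth.lean` (crux
`Summit.ValiantsHypothesis.ValiantsHypothesis.Theses.KPlusLogSqLaw.TropicalB`, item `stmt-ValiantsHypothesis-19771`, route
`KPlusLogSqLaw`; `--supports … --as helper`).  A SECTOR law (a located no-go for constructions), valid for every `K`, all exponents
and all valuations; it bounds nothing for `TropicalB` in its window and bears on neither `WeakLifting`, DoorA26/DoorA34,
`MatrixDescartes` (stmt-ValiantsHypothesis-18050) nor VP ≠ VNP.

THE LAW.  Part 1 (**binary blocks**, any design): along a dominant chain `p₀ ≺ ⋯ ≺ pₙ` at strictly increasing integer slopes, let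
`C` be a column set whose row image `(p_k).1 '' C` is the same for all `k` and whose restrictions `restr C p_k` take at most TWO
values.  Then the restriction of the chain to `C` changes AT MOST ONCE (`changes_le_one`): by the exchange principle of
`…TropicalBIntervalOpt` (`sl_lt_of_inOpt`) every change strictly raises the `C`-slope, and a two-valued sequence that changes twice
returns to a value.  Hence if `g` such blocks see every step of the chain, `n ≤ g` (`chain_le_card_blocks`).
Part 2 (**two permutations**): if every present entry lies on one of two permutation matrices `σ₀, σ₁` with a fixed class on each
(`ε i j l ≠ 0 → (i = σ₀ j ∧ l = c₀ j) ∨ (i = σ₁ j ∧ l = c₁ j)` — «at most two present (entry, class) incidences per column, arranged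
along two permutations»), then every orbit `C` of `ρ = σ₀⁻¹σ₁` is such a block: all present terms map `C` onto `σ₀(C) = σ₁(C)`
(`image_eq_of_support`), and on a ρ-orbit a present term follows `σ₀` everywhere or `σ₁` everywhere (`restr_two_valued`: if column `j`
takes `σ₁ j` then row `σ₀(ρ j) = σ₁ j` is used, so column `ρ j` cannot take `σ₀`).  The orbits partition the columns, so

  **`chain_le_size`:  n ≤ m**  (indeed `n ≤ #orbits of σ₀⁻¹σ₁`, `chain_le_of_twoPerm`)

for every sign-alternating dominant chain of such a design (unsigned form `chain_le_size_of_ne`, census currency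
`designRowD_of_twoPerm : DesignRowD d v ε m`) — the cover family is a DIRECT SUM of binary gadgets (one per orbit) whatever the
wiring, so «one binary choice per column» architectures are additive.  This generalises the tree's cyclic-bidiagonal
row (`…TropicalBCyclicBidiagonal`: `σ₀ = 1`, `σ₁ =` the rotation, one orbit) to arbitrary pairs of permutations; companion memo
HOME/val-sym-trop-p1/g14/ODOMETER-ANATOMY-g14.md §6.  [folklore]-level (exchange principle + orbit bookkeeping).
-/

set_option linter.dupNamespace false
set_option autoImplicit false

namespace Summit.ValiantsHypothesis.ValiantsHypothesis.Theorems.KPlusLogSqLaw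

open Summit.ValiantsHypothesis.ValiantsHypothesis.Theorems.MatrixDescartes.Negative
open scoped BigOperators
open Finset IntervalOpt

namespace TwoPermutations

variable {m K : ℕ} {d : Fin K → ℕ} {v ε : Fin m → Fin m → Fin K → ℤ}

/-! ## 1. Binary blocks along a dominant chain -/

/-- Along a dominant chain at strictly increasing slopes, on a column set with a common row image, two terms with different
restrictions have strictly increasing partial slope (the exchange principle of `…TropicalBIntervalOpt`). [folklore] -/
theorem sl_lt_of_chain {n : ℕ} {θ : Fin (n + 1) → ℤ} {p : Fin (n + 1) → Equiv.Perm (Fin m) × (Fin m → Fin K)}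
    (hθ : StrictMono θ) (hdom : ∀ k, IsDominant d v ε (θ k) (p k)) {C : Finset (Fin m)}
    (himg : ∀ k k', C.image (p k).1 = C.image (p k').1) {a b : Fin (n + 1)} (hab : a < b)
    (hne : restr C (p a) ≠ restr C (p b)) : sl d C (p a) < sl d C (p b) :=
  sl_lt_of_inOpt (inOpt_mono (Finset.subset_univ C) (inOpt_univ_of_isDominant (hdom a)))
    (inOpt_mono (Finset.subset_univ C) (inOpt_univ_of_isDominant (hdom b))) (himg a b) (hθ hab) hne

/-- **A two-valued block changes at most once.**  If the restrictions of the chain to `C` (common row image) take at most two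
values, then at most one step of the chain changes the restriction to `C`. [folklore] -/
theorem changes_le_one {n : ℕ} {θ : Fin (n + 1) → ℤ} {p : Fin (n + 1) → Equiv.Perm (Fin m) × (Fin m → Fin K)}
    (hθ : StrictMono θ) (hdom : ∀ k, IsDominant d v ε (θ k) (p k)) {C : Finset (Fin m)}
    (himg : ∀ k k', C.image (p k).1 = C.image (p k').1)
    (h2 : ∃ R₀ R₁ : Fin m → Option (Fin m × Fin K), ∀ k, restr C (p k) = R₀ ∨ restr C (p k) = R₁)
    {k k' : Fin n} (hk : restr C (p k.castSucc) ≠ restr C (p k.succ))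
    (hk' : restr C (p k'.castSucc) ≠ restr C (p k'.succ)) : k = k' := by
  obtain ⟨R₀, R₁, hR⟩ := h2
  -- the generic argument, for `k < k'`
  have key : ∀ k k' : Fin n, k < k' → restr C (p k.castSucc) ≠ restr C (p k.succ) →
      restr C (p k'.castSucc) ≠ restr C (p k'.succ) → False := by
    intro k k' hlt hk hk'
    have h1 : sl d C (p k.castSucc) < sl d C (p k.succ) := sl_lt_of_chain hθ hdom himg (Fin.castSucc_lt_succ (i := k)) hk
    have h2 : sl d C (p k'.castSucc) < sl d C (p k'.succ) := sl_lt_of_chain hθ hdom himg (Fin.castSucc_lt_succ (i := k')) hk'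
    have hle : k.succ ≤ k'.castSucc := by
      rw [Fin.le_iff_val_le_val, Fin.val_succ, Fin.val_castSucc]
      exact hlt
    -- the four values lie in `{R₀, R₁}`; either the pattern repeats or it is swapped
    have hvals : (restr C (p k.castSucc) = restr C (p k'.castSucc) ∧ restr C (p k.succ) = restr C (p k'.succ)) ∨
        (restr C (p k.castSucc) = restr C (p k'.succ) ∧ restr C (p k.succ) = restr C (p k'.castSucc)) := by
      rcases hR k.castSucc with ha | ha <;> rcases hR k.succ with hb | hb <;>
        rcases hR k'.castSucc with ha' | ha' <;> rcases hR k'.succ with hb' | hb'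
      all_goals (first
        | exact absurd (ha.trans hb.symm) hk
        | exact absurd (ha'.trans hb'.symm) hk'
        | exact Or.inl ⟨ha.trans ha'.symm, hb.trans hb'.symm⟩
        | exact Or.inr ⟨ha.trans hb'.symm, hb.trans ha'.symm⟩)
    rcases hvals with ⟨ea, eb⟩ | ⟨ea, eb⟩
    · -- repeated pattern: between `k.succ` and `k'.castSucc` the block returns from the second value to the first
      rcases hle.lt_or_eq with hlt' | heq
      · have hne' : restr C (p k.succ) ≠ restr C (p k'.castSucc) := by
          rw [← ea]; exact fun h => hk h.symm
        have h3 := sl_lt_of_chain hθ hdom himg hlt' hne'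
        have e1 := sl_congr (d := d) ea
        linarith
      · apply hk
        rw [ea, ← heq]
    · -- swapped pattern: the two steps raise the slope in opposite directions
      have e1 := sl_congr (d := d) ea
      have e2 := sl_congr (d := d) eb
      linarith
  rcases lt_trichotomy k k' with h | h | h
  · exact (key k k' h hk hk').elim
  · exact h
  · exact (key k' k h hk' hk).elim

/-- **BINARY-BLOCK LAW.**  If `g` column sets, each with a common row image along the chain and at most two restriction values,
see every step of a dominant chain (some block changes at each step), then the chain has at most `g` steps. [folklore] -/
theorem chain_le_card_blocks {n g : ℕ} {θ : Fin (n + 1) → ℤ} {p : Fin (n + 1) → Equiv.Perm (Fin m) × (Fin m → Fin K)}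
    (hθ : StrictMono θ) (hdom : ∀ k, IsDominant d v ε (θ k) (p k)) (C : Fin g → Finset (Fin m))
    (himg : ∀ t k k', (C t).image (p k).1 = (C t).image (p k').1)
    (h2 : ∀ t, ∃ R₀ R₁ : Fin m → Option (Fin m × Fin K), ∀ k, restr (C t) (p k) = R₀ ∨ restr (C t) (p k) = R₁)
    (hcov : ∀ k : Fin n, ∃ t, restr (C t) (p k.castSucc) ≠ restr (C t) (p k.succ)) : n ≤ g := by
  classical
  choose f hf using hcov
  have hinj : Function.Injective f := by
    intro k k' h
    have hk' : restr (C (f k)) (p k'.castSucc) ≠ restr (C (f k)) (p k'.succ) := by rw [h]; exact hf k'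
    exact changes_le_one hθ hdom (himg (f k)) (h2 (f k)) (hf k) hk'
  simpa using Fintype.card_le_of_injective f hinj

/-! ## 2. Supports on two permutation matrices -/

/-- On a `ρ`-stable column set (`ρ = σ₀⁻¹σ₁`) every present term of a design supported on `σ₀ ∪ σ₁` has the row image `σ₀(C)`.
[folklore] -/
theorem image_eq_of_support (σ₀ σ₁ : Equiv.Perm (Fin m)) (hsupp : ∀ i j l, ε i j l ≠ 0 → i = σ₀ j ∨ i = σ₁ j)
    {C : Finset (Fin m)} (hC : ∀ j, j ∈ C ↔ (σ₀⁻¹ * σ₁) j ∈ C)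
    {p : Equiv.Perm (Fin m) × (Fin m → Fin K)} (hp : termSign ε p ≠ 0) : C.image p.1 = C.image σ₀ := by
  classical
  have hpres := (termSign_ne_zero_iff ε p).1 hp
  apply Finset.eq_of_subset_of_card_le
  · intro x hx
    rw [Finset.mem_image] at hx ⊢
    obtain ⟨j, hj, rfl⟩ := hx
    rcases hsupp _ _ _ (hpres j) with h | h
    · exact ⟨j, hj, h.symm⟩
    · refine ⟨(σ₀⁻¹ * σ₁) j, (hC j).1 hj, ?_⟩
      rw [h, Equiv.Perm.mul_apply]
      exact σ₀.apply_symm_apply _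
  · rw [Finset.card_image_of_injective _ σ₀.injective, Finset.card_image_of_injective _ p.1.injective]

/-- **All or nothing on an orbit.**  If every present (entry, class) incidence lies on `(σ₀ j, j)` with class `c₀ j` or on `(σ₁ j, j)`
with class `c₁ j`, then on a MINIMAL `ρ`-stable column set `C` (`ρ = σ₀⁻¹σ₁`) a present term coincides with `(σ₀, c₀)` or with
`(σ₁, c₁)`: its restriction to `C` takes one of two values. [folklore] -/
theorem restr_two_valued (σ₀ σ₁ : Equiv.Perm (Fin m)) (c₀ c₁ : Fin m → Fin K)
    (hstat : ∀ i j l, ε i j l ≠ 0 → (i = σ₀ j ∧ l = c₀ j) ∨ (i = σ₁ j ∧ l = c₁ j))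
    {C : Finset (Fin m)} (hC : ∀ j, j ∈ C ↔ (σ₀⁻¹ * σ₁) j ∈ C)
    (hmin : ∀ S : Finset (Fin m), S ⊆ C → (∀ j, j ∈ S ↔ (σ₀⁻¹ * σ₁) j ∈ S) → S = ∅ ∨ S = C)
    {p : Equiv.Perm (Fin m) × (Fin m → Fin K)} (hp : termSign ε p ≠ 0) :
    restr C p = restr C (σ₀, c₀) ∨ restr C p = restr C (σ₁, c₁) := by
  classical
  set ρ : Equiv.Perm (Fin m) := σ₀⁻¹ * σ₁ with hρ
  have hpres := (termSign_ne_zero_iff ε p).1 hp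
  have hρj : ∀ j, σ₀ (ρ j) = σ₁ j := fun j => by
    rw [hρ, Equiv.Perm.mul_apply]
    exact σ₀.apply_symm_apply _
  have hfix_iff : ∀ j, ρ j = j ↔ σ₁ j = σ₀ j := fun j => by
    constructor
    · intro h; rw [← hρj j, h]
    · intro h; apply σ₀.injective; rw [hρj j, h]
  by_cases hfix : ∃ j ∈ C, ρ j = j
  · -- a fixed column is an orbit by itself
    obtain ⟨j, hjC, hj⟩ := hfix
    have hsing : ({j} : Finset (Fin m)) = C := by
      rcases hmin {j} (Finset.singleton_subset_iff.2 hjC) (fun j' => by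
        rw [Finset.mem_singleton, Finset.mem_singleton]
        constructor
        · intro h; rw [h, hj]
        · intro h; exact ρ.injective (h.trans hj.symm)) with h | h
      · exact absurd h (Finset.singleton_ne_empty j)
      · exact h
    rcases hstat _ _ _ (hpres j) with ⟨h1, h2⟩ | ⟨h1, h2⟩
    · left
      refine restr_eq_iff.2 fun i hi => ?_
      rw [← hsing, Finset.mem_singleton] at hi
      subst hi
      exact ⟨h1, h2⟩
    · right
      refine restr_eq_iff.2 fun i hi => ?_
      rw [← hsing, Finset.mem_singleton] at hi
      subst hi
      exact ⟨h1, h2⟩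
  · push Not at hfix
    have hne01 : ∀ j ∈ C, σ₁ j ≠ σ₀ j := fun j hj h => hfix j hj ((hfix_iff j).2 h)
    have hsupp : ∀ j, p.1 j = σ₀ j ∨ p.1 j = σ₁ j := fun j => by
      rcases hstat _ _ _ (hpres j) with ⟨h1, _⟩ | ⟨h1, _⟩
      · exact Or.inl h1
      · exact Or.inr h1
    -- the columns of `C` following `σ₁`
    set S : Finset (Fin m) := C.filter fun j => p.1 j = σ₁ j with hS
    have hSsub : S ⊆ C := Finset.filter_subset _ _
    have hfwd : ∀ j, j ∈ S → ρ j ∈ S := by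
      intro j hj
      rw [hS, Finset.mem_filter] at hj ⊢
      refine ⟨(hC j).1 hj.1, ?_⟩
      rcases hsupp (ρ j) with h | h
      · exfalso
        have : ρ j = j := p.1.injective (by rw [h, hρj j, hj.2])
        exact hfix j hj.1 this
      · exact h
    have hbwd : ∀ j, ρ j ∈ S → j ∈ S := by
      intro j hj
      rw [hS, Finset.mem_filter] at hj ⊢
      have hjC : j ∈ C := (hC j).2 hj.1
      refine ⟨hjC, ?_⟩
      -- the row `σ₁ j = σ₀ (ρ j)` is covered by some column `j''`; it can only be `j`
      obtain ⟨j'', hj''⟩ := p.1.surjective (σ₀ (ρ j))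
      rcases hsupp j'' with h | h
      · -- `σ₀ j'' = σ₀ (ρ j)` forces `j'' = ρ j`, but column `ρ j` follows `σ₁ ≠ σ₀` there
        have e : j'' = ρ j := σ₀.injective (h ▸ hj'')
        subst e
        exact absurd (hj.2.symm.trans hj'') (hne01 _ hj.1)
      · -- `σ₁ j'' = σ₀ (ρ j) = σ₁ j` forces `j'' = j`
        have e : j'' = j := σ₁.injective (by rw [← h, hj'', hρj j])
        subst e
        rw [hj'', hρj]
    have hSstab : ∀ j, j ∈ S ↔ ρ j ∈ S := fun j => ⟨hfwd j, hbwd j⟩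
    rcases hmin S hSsub hSstab with h0 | h1
    · -- nobody follows `σ₁`: the term is `(σ₀, c₀)` on `C`
      left
      refine restr_eq_iff.2 fun i hi => ?_
      have hi0 : p.1 i = σ₀ i := by
        rcases hsupp i with h | h
        · exact h
        · exfalso
          have : i ∈ S := by rw [hS, Finset.mem_filter]; exact ⟨hi, h⟩
          rw [h0] at this
          exact absurd this (Finset.notMem_empty i)
      rcases hstat _ _ _ (hpres i) with ⟨_, h2⟩ | ⟨h1, _⟩
      · exact ⟨hi0, h2⟩
      · exact absurd (h1.symm.trans hi0) (hne01 i hi)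
    · -- everybody follows `σ₁`: the term is `(σ₁, c₁)` on `C`
      right
      refine restr_eq_iff.2 fun i hi => ?_
      have hi1 : p.1 i = σ₁ i := by
        have : i ∈ S := h1 ▸ hi
        rw [hS, Finset.mem_filter] at this
        exact this.2
      rcases hstat _ _ _ (hpres i) with ⟨h1', _⟩ | ⟨_, h2⟩
      · exact absurd (hi1.symm.trans h1') (hne01 i hi)
      · exact ⟨hi1, h2⟩

/-- **TWO-PERMUTATION LAW (block form).**  A design whose present (entry, class) incidences lie on two static permutation terms
`(σ₀, c₀)`, `(σ₁, c₁)`; `g` minimal `ρ`-stable column sets covering all columns (`ρ = σ₀⁻¹σ₁`; e.g. the orbits of `ρ`).  Then every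
dominant chain with pairwise distinct consecutive terms has `n ≤ g`. [folklore] -/
theorem chain_le_of_twoPerm {n g : ℕ} (σ₀ σ₁ : Equiv.Perm (Fin m)) (c₀ c₁ : Fin m → Fin K)
    (hstat : ∀ i j l, ε i j l ≠ 0 → (i = σ₀ j ∧ l = c₀ j) ∨ (i = σ₁ j ∧ l = c₁ j))
    (C : Fin g → Finset (Fin m)) (hC : ∀ t j, j ∈ C t ↔ (σ₀⁻¹ * σ₁) j ∈ C t)
    (hmin : ∀ t (S : Finset (Fin m)), S ⊆ C t → (∀ j, j ∈ S ↔ (σ₀⁻¹ * σ₁) j ∈ S) → S = ∅ ∨ S = C t)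
    (hcover : ∀ j, ∃ t, j ∈ C t)
    {θ : Fin (n + 1) → ℤ} {p : Fin (n + 1) → Equiv.Perm (Fin m) × (Fin m → Fin K)}
    (hθ : StrictMono θ) (hdom : ∀ k, IsDominant d v ε (θ k) (p k)) (hstep : ∀ k : Fin n, p k.castSucc ≠ p k.succ) :
    n ≤ g := by
  classical
  have hsupp : ∀ i j l, ε i j l ≠ 0 → i = σ₀ j ∨ i = σ₁ j := fun i j l h => by
    rcases hstat i j l h with ⟨h1, _⟩ | ⟨h1, _⟩
    · exact Or.inl h1
    · exact Or.inr h1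
  refine chain_le_card_blocks hθ hdom C (fun t k k' => ?_) (fun t => ?_) (fun k => ?_)
  · rw [image_eq_of_support σ₀ σ₁ hsupp (hC t) (hdom k).1, image_eq_of_support σ₀ σ₁ hsupp (hC t) (hdom k').1]
  · exact ⟨restr (C t) (σ₀, c₀), restr (C t) (σ₁, c₁), fun k =>
      restr_two_valued σ₀ σ₁ c₀ c₁ hstat (hC t) (hmin t) (hdom k).1⟩
  · -- a step changes some column, which lies in some block
    by_contra hall
    push Not at hall
    apply hstep k
    have hcols : ∀ j, (p k.castSucc).1 j = (p k.succ).1 j ∧ (p k.castSucc).2 j = (p k.succ).2 j := by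
      intro j
      obtain ⟨t, ht⟩ := hcover j
      exact restr_eq_iff.1 (hall t) j ht
    refine Prod.ext (Equiv.ext fun j => (hcols j).1) (funext fun j => (hcols j).2)

/-- **TWO ENTRIES PER COLUMN ARE LINEAR (unsigned form).**  If every present (entry, class) incidence of a design of format
`(m, K)` lies on one of two static permutation terms `(σ₀, c₀)`, `(σ₁, c₁)` (any exponents, any valuations), then every dominant
chain at strictly increasing integer slopes with pairwise distinct consecutive terms has at most `m` steps — indeed at most the number
of orbits of `σ₀⁻¹σ₁` (`chain_le_of_twoPerm` with the orbits as blocks). [folklore] -/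
theorem chain_le_size_of_ne (σ₀ σ₁ : Equiv.Perm (Fin m)) (c₀ c₁ : Fin m → Fin K)
    (hstat : ∀ i j l, ε i j l ≠ 0 → (i = σ₀ j ∧ l = c₀ j) ∨ (i = σ₁ j ∧ l = c₁ j))
    {n : ℕ} {θ : Fin (n + 1) → ℤ} {p : Fin (n + 1) → Equiv.Perm (Fin m) × (Fin m → Fin K)}
    (hθ : StrictMono θ) (hdom : ∀ k, IsDominant d v ε (θ k) (p k)) (hstep : ∀ k : Fin n, p k.castSucc ≠ p k.succ) :
    n ≤ m := by
  classical
  set ρ : Equiv.Perm (Fin m) := σ₀⁻¹ * σ₁ with hρ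
  -- blocks = orbits of `ρ`
  let C : Fin m → Finset (Fin m) := fun t => Finset.univ.filter fun j => ρ.SameCycle t j
  have hmemC : ∀ t j, j ∈ C t ↔ ρ.SameCycle t j := fun t j => by
    simp only [C, Finset.mem_filter, Finset.mem_univ, true_and]
  have hC : ∀ t j, j ∈ C t ↔ ρ j ∈ C t := fun t j => by
    rw [hmemC, hmemC, Equiv.Perm.sameCycle_apply_right]
  have hmin : ∀ t (S : Finset (Fin m)), S ⊆ C t → (∀ j, j ∈ S ↔ ρ j ∈ S) → S = ∅ ∨ S = C t := by
    intro t S hS hstab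
    rcases S.eq_empty_or_nonempty with h | ⟨j₀, hj₀⟩
    · exact Or.inl h
    · right
      apply Finset.Subset.antisymm hS
      intro j hj
      have h0 : ρ.SameCycle t j₀ := (hmemC t j₀).1 (hS hj₀)
      have h1 : ρ.SameCycle t j := (hmemC t j).1 hj
      have h2 : ρ.SameCycle j₀ j := h0.symm.trans h1
      obtain ⟨i, -, hi⟩ := h2.exists_pow_eq'
      have hpow : ∀ i : ℕ, (ρ ^ i) j₀ ∈ S := by
        intro i
        induction i with
        | zero => simpa using hj₀
        | succ i ih =>
          rw [pow_succ', Equiv.Perm.mul_apply]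
          exact (hstab _).1 ih
      rw [← hi]
      exact hpow i
  have hcover : ∀ j, ∃ t, j ∈ C t := fun j => ⟨j, (hmemC j j).2 (Equiv.Perm.SameCycle.refl ρ j)⟩
  exact chain_le_of_twoPerm σ₀ σ₁ c₀ c₁ hstat C hC hmin hcover hθ hdom hstep

/-- **TWO ENTRIES PER COLUMN ARE LINEAR.**  Same, for SIGN-ALTERNATING dominant chains (the tree's census convention): at most `m`
alternations, for every `K`, all exponents and all valuations. [folklore] -/
theorem chain_le_size (σ₀ σ₁ : Equiv.Perm (Fin m)) (c₀ c₁ : Fin m → Fin K)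
    (hstat : ∀ i j l, ε i j l ≠ 0 → (i = σ₀ j ∧ l = c₀ j) ∨ (i = σ₁ j ∧ l = c₁ j))
    {n : ℕ} {θ : Fin (n + 1) → ℤ} {p : Fin (n + 1) → Equiv.Perm (Fin m) × (Fin m → Fin K)}
    (hθ : StrictMono θ) (hdom : ∀ k, IsDominant d v ε (θ k) (p k))
    (halt : ∀ k : Fin n, termSign ε (p k.castSucc) * termSign ε (p k.succ) < 0) : n ≤ m := by
  have hstep : ∀ k : Fin n, p k.castSucc ≠ p k.succ := by
    intro k h
    have := halt k
    rw [h] at this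
    exact absurd this (not_lt.2 (mul_self_nonneg _))
  exact chain_le_size_of_ne σ₀ σ₁ c₀ c₁ hstat hθ hdom hstep

/-- **Census currency.**  Such a design has the unsigned row bound `m` (`DesignRowD d v ε m` of `…TropicalBSplitDefs`). [folklore] -/
theorem designRowD_of_twoPerm (σ₀ σ₁ : Equiv.Perm (Fin m)) (c₀ c₁ : Fin m → Fin K)
    (hstat : ∀ i j l, ε i j l ≠ 0 → (i = σ₀ j ∧ l = c₀ j) ∨ (i = σ₁ j ∧ l = c₁ j)) : DesignRowD d v ε m :=
  fun _ _ _ hθ hdom hstep => chain_le_size_of_ne σ₀ σ₁ c₀ c₁ hstat hθ hdom hstep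

end TwoPermutations

end Summit.ValiantsHypothesis.ValiantsHypothesis.Theorems.KPlusLogSqLaw
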